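import Literature.Computability.AlgebraicComplexity.AlmanLi2026FreeLunchSpeedup
import Literature.Computability.AlgebraicComplexity.BlockSliceTensor
import HarnessLib

/-!
# A direct sum identity (Alman–Li 2026, Thm. 7.3): `⟨n,1,m⟩ ⊕ ⊕_{α,β} ⟨1,(n_α−1)(m_β−1),1⟩ ⊴ ⟨nm⟩ ⊕ ⟨p,1,q⟩`

Topic `Literature/Computability/AlgebraicComplexity` (family `MatrixMultiplication`). Source: J. Alman,
B. Li, *Asymptotic Rank Speedup Theorems, Revisited*, arXiv:2605.21738 (2026), §7.3 "A direct sum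
identity", Theorem 7.3 with its printed proof (held text `paper:arxiv-2605.21738`, p. 19 L79–110 and
p. 20 L7–135), read first-hand.

## The printed statement (p. 19 L89–110)

"Theorem 7.3. Let `p, q` be positive integers, and let `{n_α}_{1≤α≤p}` and `{m_β}_{1≤β≤q}` be sequences
of positive integers. Set `n = ∑_α n_α`, `m = ∑_β m_β`. Then there exists a degeneration between direct
sums of matrix multiplication tensors:
`⟨n,1,m⟩ ⊕ ⊕_{1≤α≤p, 1≤β≤q} ⟨1,(n_α−1)(m_β−1),1⟩ ⊴ ⟨nm⟩ ⊕ ⟨p,1,q⟩`."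
It "generalizes Schönhage's classical construction [Sch81Tau]: `⟨n,1,m⟩ ⊕ ⟨1,(n−1)(m−1),1⟩ ⊴ ⟨nm+1⟩`"
(p. 19 L80–86), and "in the special case `n_α = n` and `m_β = m` for all `α, β`, our identity becomes
`⟨pn,1,qm⟩ ⊕ pq ⊙ ⟨1,(n−1)(m−1),1⟩ ⊴ ⟨pqnm⟩ ⊕ ⟨p,1,q⟩`" (p. 19 L127–133).

## The printed proof (p. 20), followed here step by step

Write `⟨n,1,m⟩ = ∑_{i,j} x_i y_j z_{ij}` and `S = ⟨nm⟩ ⊕ ⟨p,1,q⟩ = ∑_{ij} u_{ij} v_{ij} w_{ij} − ∑_{α,β} u'_α v'_β w'_{αβ}`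
(the sign is immaterial up to isomorphism; here it is moved into the functional `C'`). Fix the partitions
`[n] = ⊔_α I_α`, `[m] = ⊔_β J_β` — here: block maps `α : ι → P`, `β : κ → Q` on finite index types.
(1) The maps `A : x_i ↤ u_{ij}, ∑_{i∈I_α} x_i ↤ u'_α`, `B : y_j ↤ v_{ij}, ∑_{j∈J_β} y_j ↤ v'_β`,
`C : z_{ij} ↤ w_{ij}, 0 ↤ w'_{αβ}` give a restriction `⟨n,1,m⟩ ≤ S` ("a redundant restriction").
(2) The functional(s) `C' : w'_{α(i)β(j)} ↤ w_{ij}, w'_{αβ} ↤ w'_{αβ}` satisfy `(A ⊗ B ⊗ C') S = 0`, so the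
free-lunch speedup theorem (Thm. 5.1, the tree's `AlmanLi2026.thm51`) yields a direct summand
`T' = (A' ⊗ B' ⊗ C') S` with `A'` = the annihilator of the vectors `u'_α − ∑_{i∈I_α} u_{ij}` and `B'`
likewise. (3) Choosing distinguished indices `i*_α ∈ I_α`, `j*_β ∈ J_β` — here: sections `istar`,
`jstar` of the block maps — and applying the projections `π_U`, `π_V` that kill `u'_α`, the
distinguished columns `u_{i j*_β}`, `v'_β` and the distinguished rows `v_{i*_α j}`, one obtains the
further restriction `T* = ∑_{α,β} (∑_{i∈I_α∖i*_α} ∑_{j∈J_β∖j*_β} u_{ij} v_{ij}) w_{αβ} ≅ ⊕_{α,β} ⟨1,(n_α−1)(m_β−1),1⟩`.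
In coordinates, steps (2)+(3) amount to feeding `thm51` directly with the ROWS of `π_U ∘ A'`, `π_V ∘ B'`:
for a surviving pair `x = (i,j)` (`i ≠ i*_{α(i)}`, `j ≠ j*_{β(j)}`) the functional
`u_{ij} − u_{i*_{α(i)} j}` on the `u`-variables (zero on the `u'_α`), which lies in `A'`, and
`v_{ij} − v_{i j*_{β(j)}}` in `B'`; the contraction `(A'' ⊗ B'' ⊗ C') S` is then exactly `T*`
(`AlmanLi2026.thm73_coord`, the five sum identities of Thm. 5.1 checked entrywise).

## The form proved here

* `AlmanLi2026.thm73_coord` — generic index types `ι` (rows, `n = |ι|`), `κ` (columns), block labels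
  `P`, `Q`, block maps `α, β` with sections `istar, jstar` (= partitions into NONEMPTY labelled parts, as
  printed: "positive integers `n_α`, `m_β`"); all four tensors in coordinates with the modes ordered
  `(x/u, y/v, z/w)`: `⟨nm⟩ = [x = y = z]` on `ι × κ`, `⟨p,1,q⟩ = [w = (u,v)]` on `P, Q, P × Q`,
  `⟨n,1,m⟩ = [z = (x,y)]` on `ι, κ, ι × κ`, and `⊕_{α,β} ⟨1,(n_α−1)(m_β−1),1⟩ = blockSliceTensor K g`
  (`BlockSliceTensor.lean`) for the block map `g(i,j) = (α i, β j)` on the surviving pairs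
  `{(i,j) : i ≠ i*_{α i}, j ≠ j*_{β j}}`, whose fibre over `(a,b)` has the printed size
  `(n_a − 1)(m_b − 1)` (`AlmanLi2026.thm73_card_fibre`).
* `AlmanLi2026.thm73` — the same with the tree's `unitTensor K (n*m)` for `⟨nm⟩` and
  `rotate (matMulTensor K p 1 q)`, `rotate (matMulTensor K n 1 m)` for `⟨p,1,q⟩`, `⟨n,1,m⟩`
  (`ι = Fin n`, `κ = Fin m`, `P = Fin p`, `Q = Fin q`, arbitrary block maps with sections), by the `0/1`
  relabelling restrictions between the two coordinate systems.
* `AlmanLi2026.thm73_schonhage` — one block on each side (`p = q = 1`, `i* = 0`, `j* = 0`):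
  `⟨n,1,m⟩ ⊕ ⟨1,(n−1)(m−1),1⟩ ⊴ ⟨nm⟩ ⊕ ⟨1,1,1⟩`, Schönhage's construction in the form the theorem
  specialises to (`⟨nm⟩ ⊕ ⟨1,1,1⟩ ≅ ⟨nm+1⟩`).

Everything holds over any commutative ring `K` (the degeneration is Thm. 5.1's explicit order-2 one).

## References

* J. Alman, B. Li, *Asymptotic Rank Speedup Theorems, Revisited*, arXiv:2605.21738 (2026), Thm. 7.3 and
  its proof (§7.3, pp. 19–20); Thm. 5.1. [AlmanLi2026]
* A. Schönhage, *Partial and total matrix multiplication*, SIAM J. Comput. 10 (1981) 434–455 (the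
  identity `⟨n,1,m⟩ ⊕ ⟨1,(n−1)(m−1),1⟩ ⊴ ⟨nm+1⟩` being generalised, as attributed on p. 19). [Schonhage1981]
* M. Bläser, *Fast Matrix Multiplication*, Theory of Computing Library, Graduate Surveys 5 (2013),
  Def. 7.2 / Lemma 5.4 (relabelling restrictions). [Blaser2013]
-/

noncomputable section

open scoped BigOperators

namespace Literature.Computability.AlgebraicComplexity

universe u

variable {K : Type u} [CommRing K]
variable {ι κ P Q : Type*} [Fintype ι] [Fintype κ] [Fintype P] [Fintype Q]
  [DecidableEq ι] [DecidableEq κ] [DecidableEq P] [DecidableEq Q]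

namespace AlmanLi2026

/-! ## Sums against the source `S = ⟨nm⟩ ⊕ ⟨p,1,q⟩` and two delta-function sums -/

/-- Contracting `S = ⟨nm⟩ ⊕ ⟨p,1,q⟩` (coordinates: `[x=y=z]` on `ι × κ`, `[w=(u,v)]` on `P, Q, P × Q`)
against block vectors: only the diagonal of `⟨nm⟩` and the support `w'_{αβ} ↔ (u'_α, v'_β)` of
`⟨p,1,q⟩` contribute. [cite: AlmanLi2026, Thm. 7.3 (proof: "S ≔ ⟨nm⟩ ⊕ ⟨p,1,q⟩ = ∑ u_{ij}v_{ij}w_{ij} − ∑ u'_α v'_β w'_{αβ}")] -/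
theorem thm73_sum_source (fD : ι × κ → K) (fM : P → K) (gD : ι × κ → K) (gM : Q → K)
    (hD : ι × κ → K) (hM : P × Q → K) :
    (∑ a, ∑ b, ∑ c, Sum.elim fD fM a * Sum.elim gD gM b * Sum.elim hD hM c *
      directSumTensor (fun x y z : ι × κ => if x = y ∧ y = z then (1 : K) else 0)
        (fun (u : P) (v : Q) (w : P × Q) => if w = (u, v) then (1 : K) else 0) a b c) =
      (∑ z, fD z * gD z * hD z) + ∑ a, ∑ b, fM a * gM b * hM (a, b) := by
  simp only [Fintype.sum_sum_type, Sum.elim_inl, Sum.elim_inr, directSumTensor_inl,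
    directSumTensor_inr, directSumTensor_inl_inr, directSumTensor_inr_inl, directSumTensor_mixed₃_inr,
    directSumTensor_mixed₃_inl, mul_zero, Finset.sum_const_zero, add_zero, zero_add]
  congr 1
  · refine Finset.sum_congr rfl fun z _ => ?_
    rw [Finset.sum_eq_single z (fun y _ hy => by simp [Ne.symm hy]) (by simp),
      Finset.sum_eq_single z (fun w _ hw => by simp [Ne.symm hw]) (by simp)]
    simp
  · refine Finset.sum_congr rfl fun a _ => Finset.sum_congr rfl fun b _ => ?_
    simp only [mul_ite, mul_one, mul_zero, Finset.sum_ite_eq', Finset.mem_univ, if_true]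

/-- `∑_z (δ_{z,u} − δ_{z,u'}) G(z) = G(u) − G(u')`. [folklore] -/
private theorem sum_ite_sub_ite_mul {σ : Type*} [Fintype σ] [DecidableEq σ] (u u' : σ) (G : σ → K) :
    (∑ z, ((if z = u then (1 : K) else 0) - (if z = u' then 1 else 0)) * G z) = G u - G u' := by
  simp [sub_mul, Finset.sum_sub_distrib, ite_mul]

/-- `∑_z F(z) (δ_{z,u} − δ_{z,u'}) G(z) = F(u)G(u) − F(u')G(u')`. [folklore] -/
private theorem sum_mul_ite_sub_ite_mul {σ : Type*} [Fintype σ] [DecidableEq σ] (u u' : σ) (F G : σ → K) :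
    (∑ z, F z * ((if z = u then (1 : K) else 0) - (if z = u' then 1 else 0)) * G z) =
      F u * G u - F u' * G u' := by
  simp [mul_sub, sub_mul, Finset.sum_sub_distrib, mul_ite, ite_mul]

/-! ## Thm. 7.3 in coordinates (generic index types) -/

/-- **Alman–Li 2026, Thm. 7.3 (a direct sum identity), in coordinates.** For block maps
`α : ι → P`, `β : κ → Q` with sections `istar`, `jstar` (a partition of the `n = |ι|` rows into `|P|`
nonempty labelled parts `I_a = α⁻¹(a)` with distinguished elements `i*_a`, and likewise for the
`m = |κ|` columns):
`⟨n,1,m⟩ ⊕ ⊕_{(a,b) ∈ P × Q} ⟨1,(|I_a|−1)(|J_b|−1),1⟩ ⊴ ⟨nm⟩ ⊕ ⟨p,1,q⟩`,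
the family direct sum being `blockSliceTensor K g` for `g(i,j) = (α i, β j)` on the surviving pairs
`{(i,j) : i ≠ i*_{α i}, j ≠ j*_{β j}}` — the tensor `T* = ∑_{a,b} (∑_{i∈I_a∖i*_a} ∑_{j∈J_b∖j*_b} u_{ij}v_{ij}) w_{ab}`
of the printed proof. Proof as printed: Thm. 5.1 (`thm51`) for the redundant restriction
`⟨n,1,m⟩ ≤ ⟨nm⟩ ⊕ ⟨p,1,q⟩`, the functional `w_{ij} ↦ w'_{α(i)β(j)}`, and the projected annihilator rows
`u_{ij} − u_{i*j}`, `v_{ij} − v_{ij*}`. [cite: AlmanLi2026, Thm. 7.3] -/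
theorem thm73_coord (α : ι → P) (β : κ → Q) (istar : P → ι) (jstar : Q → κ)
    (hα : ∀ a, α (istar a) = a) (hβ : ∀ b, β (jstar b) = b) :
    AlgDegeneratesTo
      (directSumTensor (fun x y z : ι × κ => if x = y ∧ y = z then (1 : K) else 0)
        (fun (u : P) (v : Q) (w : P × Q) => if w = (u, v) then (1 : K) else 0))
      (directSumTensor (fun (i : ι) (j : κ) (z : ι × κ) => if z = (i, j) then (1 : K) else 0)
        (blockSliceTensor K (fun x : {z : ι × κ // z.1 ≠ istar (α z.1) ∧ z.2 ≠ jstar (β z.2)} =>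
          (α x.1.1, β x.1.2)))) := by
  -- facts about the distinguished representatives
  have hαι : ∀ i, α (istar (α i)) = α i := fun i => hα (α i)
  have hβκ : ∀ j, β (jstar (β j)) = β j := fun j => hβ (β j)
  refine thm51
    (A := fun i => Sum.elim (fun z : ι × κ => if z.1 = i then (1 : K) else 0)
      (fun a => if α i = a then 1 else 0))
    (B := fun j => Sum.elim (fun z : ι × κ => if z.2 = j then (1 : K) else 0)
      (fun b => if β j = b then 1 else 0))
    (C₀ := fun z => Sum.elim (fun z' : ι × κ => if z' = z then (1 : K) else 0) (fun _ => 0))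
    (C' := fun c => Sum.elim (fun z : ι × κ => if (α z.1, β z.2) = c then (1 : K) else 0)
      (fun c' => if c' = c then -1 else 0))
    (A' := fun x => Sum.elim (fun z : ι × κ =>
      (if z = x.1 then (1 : K) else 0) - (if z = (istar (α x.1.1), x.1.2) then 1 else 0)) (fun _ => 0))
    (B' := fun y => Sum.elim (fun z : ι × κ =>
      (if z = y.1 then (1 : K) else 0) - (if z = (y.1.1, jstar (β y.1.2)) then 1 else 0)) (fun _ => 0))
    ?_ ?_ ?_ ?_ ?_
  · -- (1) the redundant restriction `⟨n,1,m⟩ = (A ⊗ B ⊗ C) S`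
    intro i j z
    rw [thm73_sum_source]
    obtain ⟨z₁, z₂⟩ := z
    simp only [mul_ite, mul_one, mul_zero, Finset.sum_ite_eq', Finset.mem_univ, if_true,
      Finset.sum_const_zero, add_zero, Prod.mk.injEq]
    by_cases h1 : z₁ = i <;> by_cases h2 : z₂ = j <;> simp [h1, h2]
  · -- (3) `T* = (A'' ⊗ B'' ⊗ C') S` is the block one-slice tensor
    intro x y c
    rw [thm73_sum_source]
    simp only [mul_assoc, sum_ite_sub_ite_mul, zero_mul, Finset.sum_const_zero, add_zero]
    -- the three impossible coincidences
    have F1 : x.1 ≠ (y.1.1, jstar (β y.1.2)) := by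
      intro h
      have h2 : x.1.2 = jstar (β y.1.2) := congrArg Prod.snd h
      apply x.2.2
      rw [h2, hβ]
    have F2 : (istar (α x.1.1), x.1.2) ≠ y.1 := by
      intro h
      have h1 : istar (α x.1.1) = y.1.1 := congrArg Prod.fst h
      apply y.2.1
      rw [← h1, hαι]
    have F3 : (istar (α x.1.1), x.1.2) ≠ (y.1.1, jstar (β y.1.2)) := by
      intro h
      have h1 : istar (α x.1.1) = y.1.1 := congrArg Prod.fst h
      apply y.2.1
      rw [← h1, hαι]
    rw [if_neg F1, if_neg F2, if_neg F3, sub_zero, sub_zero, zero_mul, sub_zero, blockSliceTensor_apply]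
    by_cases hxy : x = y
    · subst hxy
      simp
    · have hxy' : x.1 ≠ y.1 := fun h => hxy (Subtype.ext h)
      simp [hxy, hxy']
  · -- (2a) `C'` annihilates: `(A ⊗ B ⊗ C') S = 0`
    intro i j c
    rw [thm73_sum_source, Fintype.sum_prod_type,
      Finset.sum_eq_single i (fun i' _ hi' => by simp [hi']) (by simp),
      Finset.sum_eq_single j (fun j' _ hj' => by simp [hj']) (by simp),
      Finset.sum_eq_single (α i) (fun a _ ha => by simp [Ne.symm ha]) (by simp),
      Finset.sum_eq_single (β j) (fun b _ hb => by simp [Ne.symm hb]) (by simp)]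
    by_cases h : (α i, β j) = c <;> simp [h]
  · -- (2b) the rows `u_{ij} − u_{i*j}` lie in `A' = {u : (u ⊗ B ⊗ C') S = 0}`
    intro x j c
    rw [thm73_sum_source]
    simp only [mul_assoc, sum_ite_sub_ite_mul, zero_mul, Finset.sum_const_zero, add_zero, hαι, sub_self]
  · -- (2c) the rows `v_{ij} − v_{ij*}` lie in `B' = {v : (A ⊗ v ⊗ C') S = 0}`
    intro i y c
    rw [thm73_sum_source]
    simp only [sum_mul_ite_sub_ite_mul, mul_zero, zero_mul, Finset.sum_const_zero, add_zero, hβκ,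
      sub_self]

omit [Fintype P] [Fintype Q] in
/-- The blocks of `T*` have the printed sizes: the fibre of `g(i,j) = (α i, β j)` over `(a,b)` among
the surviving pairs has `(|I_a| − 1)(|J_b| − 1)` elements (`I_a ∖ {i*_a}` times `J_b ∖ {j*_b}`).
[cite: AlmanLi2026, Thm. 7.3 (proof, last display: "≅ ⊕_{α,β} ⟨1,(n_α−1)(m_β−1),1⟩")] -/
theorem thm73_card_fibre (α : ι → P) (β : κ → Q) (istar : P → ι) (jstar : Q → κ)
    (hα : ∀ a, α (istar a) = a) (hβ : ∀ b, β (jstar b) = b) (a : P) (b : Q) :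
    Fintype.card {x : {z : ι × κ // z.1 ≠ istar (α z.1) ∧ z.2 ≠ jstar (β z.2)} //
        (α x.1.1, β x.1.2) = (a, b)} =
      ((Finset.univ.filter fun i => α i = a).card - 1) *
        ((Finset.univ.filter fun j => β j = b).card - 1) := by
  classical
  -- the fibre is in bijection with `(I_a ∖ {i*_a}) × (J_b ∖ {j*_b})`
  have e : {x : {z : ι × κ // z.1 ≠ istar (α z.1) ∧ z.2 ≠ jstar (β z.2)} //
      (α x.1.1, β x.1.2) = (a, b)} ≃
      {i // α i = a ∧ i ≠ istar a} × {j // β j = b ∧ j ≠ jstar b} :=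
    { toFun := fun x => ⟨⟨x.1.1.1, ⟨(Prod.mk.inj x.2).1, by
          have h := x.1.2.1; rw [(Prod.mk.inj x.2).1] at h; exact h⟩⟩,
        ⟨x.1.1.2, ⟨(Prod.mk.inj x.2).2, by
          have h := x.1.2.2; rw [(Prod.mk.inj x.2).2] at h; exact h⟩⟩⟩
      invFun := fun y => ⟨⟨(y.1.1, y.2.1), ⟨by
          have h := y.1.2.2; have e := y.1.2.1; simp only; rw [e]; exact h, by
          have h := y.2.2.2; have e := y.2.2.1; simp only; rw [e]; exact h⟩⟩,
          show (α y.1.1, β y.2.1) = (a, b) from Prod.ext y.1.2.1 y.2.2.1⟩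
      left_inv := fun x => rfl
      right_inv := fun y => rfl }
  rw [Fintype.card_congr e, Fintype.card_prod]
  have hI : Fintype.card {i // α i = a ∧ i ≠ istar a} =
      (Finset.univ.filter fun i => α i = a).card - 1 := by
    rw [Fintype.card_subtype]
    have : (Finset.univ.filter fun i => α i = a ∧ i ≠ istar a) =
        (Finset.univ.filter fun i => α i = a).erase (istar a) := by
      ext i
      simp [Finset.mem_erase, and_comm]
    rw [this, Finset.card_erase_of_mem (by simp [hα])]
  have hJ : Fintype.card {j // β j = b ∧ j ≠ jstar b} =
      (Finset.univ.filter fun j => β j = b).card - 1 := by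
    rw [Fintype.card_subtype]
    have : (Finset.univ.filter fun j => β j = b ∧ j ≠ jstar b) =
        (Finset.univ.filter fun j => β j = b).erase (jstar b) := by
      ext j
      simp [Finset.mem_erase, and_comm]
    rw [this, Finset.card_erase_of_mem (by simp [hβ])]
  rw [hI, hJ]

/-! ## Thm. 7.3 in the tree's `⟨k,m,n⟩` / `⟨r⟩` vocabulary (`Fin` index types) -/

/-- `⟨N⟩ ≥ [x = y = z]` on any index type `σ` embedded in `Fin N` (relabel / zero-pad).
[cite: Blaser2013, Lemma 5.4] -/
theorem tensorRestrictsTo_unitTensor_diag {σ : Type*} [Fintype σ] [DecidableEq σ] {N : ℕ}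
    (E : σ → Fin N) (hE : Function.Injective E) :
    TensorRestrictsTo (unitTensor K N) (fun x y z : σ => if x = y ∧ y = z then (1 : K) else 0) := by
  have e : (fun x y z : σ => if x = y ∧ y = z then (1 : K) else 0) = fun x y z =>
      unitTensor K N (E x) (E y) (E z) := by
    funext x y z
    simp only [unitTensor_apply, hE.eq_iff]
  rw [e]
  exact tensorRestrictsTo_precomp _ _ _ _

/-- `⟨p,1,q⟩` (modes rotated to `(u', v', w')`) `≥ [w = (u,v)]` on `Fin p, Fin q, Fin p × Fin q`
(drop the trivial `Fin 1` coordinates). [cite: Blaser2013, Lemma 5.4] -/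
theorem tensorRestrictsTo_rotate_matMulTensor_pair (p q : ℕ) :
    TensorRestrictsTo (rotate (matMulTensor K p 1 q))
      (fun (u : Fin p) (v : Fin q) (w : Fin p × Fin q) => if w = (u, v) then (1 : K) else 0) := by
  have e : (fun (u : Fin p) (v : Fin q) (w : Fin p × Fin q) => if w = (u, v) then (1 : K) else 0) =
      fun u v w => rotate (matMulTensor K p 1 q) ((u, 0) : Fin p × Fin 1) (((0 : Fin 1), v)) (id w) := by
    funext u v w
    obtain ⟨w₁, w₂⟩ := w
    simp [rotate_apply, matMulTensor, Prod.mk.injEq]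
  rw [e]
  exact tensorRestrictsTo_precomp _ _ _ _

/-- `[z = (x,y)]` on `ι, κ, ι × κ` `≥ ⟨N,1,M⟩` (modes rotated to `(x, y, z)`) along injections
`Fin N ↪ ι`, `Fin M ↪ κ` (insert the trivial `Fin 1` coordinates, relabel, zero-pad).
[cite: Blaser2013, Lemma 5.4] -/
theorem tensorRestrictsTo_pair_rotate_matMulTensor {N M : ℕ} (eι : Fin N → ι) (eκ : Fin M → κ)
    (hι : Function.Injective eι) (hκ : Function.Injective eκ) :
    TensorRestrictsTo (fun (i : ι) (j : κ) (z : ι × κ) => if z = (i, j) then (1 : K) else 0)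
      (rotate (matMulTensor K N 1 M)) := by
  have e : rotate (matMulTensor K N 1 M) = fun x y z =>
      (fun (i : ι) (j : κ) (z : ι × κ) => if z = (i, j) then (1 : K) else 0)
        (eι x.1) (eκ y.2) (eι z.1, eκ z.2) := by
    funext x y z
    obtain ⟨i, u⟩ := x
    obtain ⟨u', j⟩ := y
    obtain ⟨z₁, z₂⟩ := z
    simp [rotate_apply, matMulTensor, Prod.mk.injEq, Subsingleton.elim u u', hι.eq_iff, hκ.eq_iff]
  rw [e]
  exact tensorRestrictsTo_precomp _ _ _ _

/-- **Alman–Li 2026, Thm. 7.3 (a direct sum identity)** in the tree's vocabulary: for every labelled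
partition of `[n]` into `p` nonempty parts (`α : Fin n → Fin p` with a section `istar` of distinguished
elements `i*_a`) and of `[m]` into `q` nonempty parts (`β`, `jstar`),
`⟨n,1,m⟩ ⊕ ⊕_{a,b} ⟨1,(n_a−1)(m_b−1),1⟩ ⊴ ⟨nm⟩ ⊕ ⟨p,1,q⟩`
with `⟨nm⟩ = unitTensor K (n*m)`, `⟨p,1,q⟩ = rotate (matMulTensor K p 1 q)` and
`⟨n,1,m⟩ = rotate (matMulTensor K n 1 m)` (modes `(x,y,z)`), and the family direct sum
`⊕_{a,b} ⟨1,(n_a−1)(m_b−1),1⟩ = blockSliceTensor K ((i,j) ↦ (α i, β j))` on the surviving pairs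
`{(i,j) : i ≠ i*_{α i}, j ≠ j*_{β j}}` (block sizes `(n_a−1)(m_b−1)`: `thm73_card_fibre`).
[cite: AlmanLi2026, Thm. 7.3] -/
theorem thm73 (n m p q : ℕ) (α : Fin n → Fin p) (β : Fin m → Fin q) (istar : Fin p → Fin n)
    (jstar : Fin q → Fin m) (hα : ∀ a, α (istar a) = a) (hβ : ∀ b, β (jstar b) = b) :
    AlgDegeneratesTo
      (directSumTensor (unitTensor K (n * m)) (rotate (matMulTensor K p 1 q)))
      (directSumTensor (rotate (matMulTensor K n 1 m))
        (blockSliceTensor K (fun x : {z : Fin n × Fin m // z.1 ≠ istar (α z.1) ∧ z.2 ≠ jstar (β z.2)} =>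
          (α x.1.1, β x.1.2)))) := by
  have h := thm73_coord (K := K) α β istar jstar hα hβ
  have hS := (tensorRestrictsTo_unitTensor_diag (K := K) (finProdFinEquiv : Fin n × Fin m ≃ Fin (n * m))
    finProdFinEquiv.injective).directSum (tensorRestrictsTo_rotate_matMulTensor_pair (K := K) p q)
  have hT := (tensorRestrictsTo_pair_rotate_matMulTensor (K := K) (id : Fin n → Fin n) (id : Fin m → Fin m)
    Function.injective_id Function.injective_id).directSum
    (TensorRestrictsTo.refl (blockSliceTensor K
      (fun x : {z : Fin n × Fin m // z.1 ≠ istar (α z.1) ∧ z.2 ≠ jstar (β z.2)} => (α x.1.1, β x.1.2))))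
  exact (hS.algDegeneratesTo_trans h).trans_restrictsTo hT

/-! ## Equal blocks: `⟨pn,1,qm⟩ ⊕ pq ⊙ ⟨1,(n−1)(m−1),1⟩ ⊴ ⟨pqnm⟩ ⊕ ⟨p,1,q⟩` -/

/-- **Alman–Li 2026, Thm. 7.3, the special case `n_α = n`, `m_β = m`** (p. 19 L127–133: "our identity
becomes `⟨pn,1,qm⟩ ⊕ pq ⊙ ⟨1,(n−1)(m−1),1⟩ ⊴ ⟨pqnm⟩ ⊕ ⟨p,1,q⟩`"), here with `n+1`, `m+1` for `n`, `m`
and `pq ⊙ X = ⟨pq⟩ ⊠ X`: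
`⟨p(n+1),1,q(m+1)⟩ ⊕ ⟨pq⟩ ⊠ ⟨1,nm,1⟩ ⊴ ⟨p(n+1)·q(m+1)⟩ ⊕ ⟨p,1,q⟩`. From `thm73_coord` with the blocks
`Fin p × Fin (n+1) → Fin p`, `Fin q × Fin (m+1) → Fin q` and distinguished elements `(a,0)`, `(b,0)`;
the surviving pairs `((a,i+1),(b,j+1))` relabel the equal-blocks tensor `blockSliceTensor K Prod.fst`
on `Fin (pq) × (Fin n × Fin m)`, which is `⟨pq⟩ ⊠ ⟨1,nm,1⟩` (`BlockSliceTensor.lean`).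
[cite: AlmanLi2026, Thm. 7.3 (special case `n_α = n`, `m_β = m`)] -/
theorem thm73_uniform (p q n m : ℕ) :
    AlgDegeneratesTo
      (directSumTensor (unitTensor K (p * (n + 1) * (q * (m + 1)))) (rotate (matMulTensor K p 1 q)))
      (directSumTensor (rotate (matMulTensor K (p * (n + 1)) 1 (q * (m + 1))))
        (kroneckerTensor (unitTensor K (p * q)) (rotate (oneSliceTensor K (Fin n × Fin m))))) := by
  have h := thm73_coord (K := K) (Prod.fst : Fin p × Fin (n + 1) → Fin p)
    (Prod.fst : Fin q × Fin (m + 1) → Fin q) (fun a => (a, 0)) (fun b => (b, 0)) (fun _ => rfl)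
    (fun _ => rfl)
  -- source side: relabel `⟨p(n+1) q(m+1)⟩` and `⟨p,1,q⟩`
  have hS := (tensorRestrictsTo_unitTensor_diag (K := K)
      (((Equiv.prodCongr finProdFinEquiv finProdFinEquiv).trans finProdFinEquiv :
        (Fin p × Fin (n + 1)) × (Fin q × Fin (m + 1)) ≃ Fin (p * (n + 1) * (q * (m + 1)))))
      (Equiv.injective _)).directSum (tensorRestrictsTo_rotate_matMulTensor_pair (K := K) p q)
  -- target side, first summand: `⟨p(n+1), 1, q(m+1)⟩`
  have hT₁ := tensorRestrictsTo_pair_rotate_matMulTensor (K := K)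
    (finProdFinEquiv.symm : Fin (p * (n + 1)) → Fin p × Fin (n + 1))
    (finProdFinEquiv.symm : Fin (q * (m + 1)) → Fin q × Fin (m + 1))
    (Equiv.injective _) (Equiv.injective _)
  -- target side, second summand: the surviving pairs are `pq` equal blocks of size `nm`
  have hT₂ : TensorRestrictsTo
      (blockSliceTensor K (fun x : {z : (Fin p × Fin (n + 1)) × (Fin q × Fin (m + 1)) //
          z.1 ≠ (fun a : Fin p => (a, (0 : Fin (n + 1)))) (Prod.fst z.1) ∧
          z.2 ≠ (fun b : Fin q => (b, (0 : Fin (m + 1)))) (Prod.fst z.2)} =>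
        (Prod.fst x.1.1, Prod.fst x.1.2)))
      (kroneckerTensor (unitTensor K (p * q)) (rotate (oneSliceTensor K (Fin n × Fin m)))) := by
    refine TensorRestrictsTo.trans ?_ (tensorRestrictsTo_blockSliceTensor_fst_kronecker (K := K) (p * q))
    refine tensorRestrictsTo_blockSliceTensor_of_comp_eq
      (e := fun y : Fin (p * q) × (Fin n × Fin m) =>
        ⟨(((finProdFinEquiv.symm y.1).1, y.2.1.succ), ((finProdFinEquiv.symm y.1).2, y.2.2.succ)),
          ⟨fun h' => Fin.succ_ne_zero _ (congrArg Prod.snd h'),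
            fun h' => Fin.succ_ne_zero _ (congrArg Prod.snd h')⟩⟩)
      (f := fun c : Fin (p * q) => finProdFinEquiv.symm c) ?_ (Equiv.injective _) (fun _ => rfl)
    intro y y' hyy'
    have h1 := congrArg (fun x : {z : (Fin p × Fin (n + 1)) × (Fin q × Fin (m + 1)) // _} => x.1) hyy'
    simp only [Prod.mk.injEq, Fin.succ_inj] at h1
    obtain ⟨⟨ha, hu⟩, hb, hv⟩ := h1
    have hc : finProdFinEquiv.symm y.1 = finProdFinEquiv.symm y'.1 := Prod.ext ha hb
    exact Prod.ext (finProdFinEquiv.symm.injective hc) (Prod.ext hu hv)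
  exact (hS.algDegeneratesTo_trans h).trans_restrictsTo (hT₁.directSum hT₂)

/-! ## Thm. 7.3 with the printed numeric data `(n_α)`, `(m_β)` -/

/-- **Alman–Li 2026, Thm. 7.3, literally**: for positive integers `n_a` (`a < p`) and `m_b` (`b < q`),
`n = ∑ n_a`, `m = ∑ m_b`,
`⟨n,1,m⟩ ⊕ ⊕_{(a,b)} ⟨1,(n_a−1)(m_b−1),1⟩ ⊴ ⟨nm⟩ ⊕ ⟨p,1,q⟩`,
the family direct sum being `blockSliceTensor K Sigma.fst` on `Σ (a,b), Fin ((n_a−1)(m_b−1))` — the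
blocks `I_a = {a} × Fin n_a` of `ι = Σ a, Fin n_a` with distinguished elements `(a, 0)`.
[cite: AlmanLi2026, Thm. 7.3] -/
theorem thm73_sizes (p q : ℕ) (ns : Fin p → ℕ) (ms : Fin q → ℕ) (hn : ∀ a, 1 ≤ ns a)
    (hm : ∀ b, 1 ≤ ms b) :
    AlgDegeneratesTo
      (directSumTensor (unitTensor K ((∑ a, ns a) * (∑ b, ms b))) (rotate (matMulTensor K p 1 q)))
      (directSumTensor (rotate (matMulTensor K (∑ a, ns a) 1 (∑ b, ms b)))
        (blockSliceTensor K (Sigma.fst :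
          (Σ ab : Fin p × Fin q, Fin ((ns ab.1 - 1) * (ms ab.2 - 1))) → Fin p × Fin q))) := by
  classical
  -- Thm. 7.3 in coordinates for `ι = Σ a, Fin n_a`, `κ = Σ b, Fin m_b`, blocks = first components
  have h := thm73_coord (K := K) (Sigma.fst : (Σ a : Fin p, Fin (ns a)) → Fin p)
    (Sigma.fst : (Σ b : Fin q, Fin (ms b)) → Fin q) (fun a => ⟨a, ⟨0, hn a⟩⟩) (fun b => ⟨b, ⟨0, hm b⟩⟩)
    (fun _ => rfl) (fun _ => rfl)
  -- source side
  have hS := (tensorRestrictsTo_unitTensor_diag (K := K)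
      (fun z : (Σ a : Fin p, Fin (ns a)) × (Σ b : Fin q, Fin (ms b)) =>
        finProdFinEquiv (finSigmaFinEquiv z.1, finSigmaFinEquiv z.2))
      (fun z z' hzz' => by
        have h1 := finProdFinEquiv.injective hzz'
        simp only [Prod.mk.injEq, EmbeddingLike.apply_eq_iff_eq] at h1
        exact Prod.ext h1.1 h1.2)).directSum
    (tensorRestrictsTo_rotate_matMulTensor_pair (K := K) p q)
  -- target side, `⟨n,1,m⟩`
  have hT₁ := tensorRestrictsTo_pair_rotate_matMulTensor (K := K)
    (ι := (Σ a : Fin p, Fin (ns a))) (κ := (Σ b : Fin q, Fin (ms b)))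
    (finSigmaFinEquiv.symm) (finSigmaFinEquiv.symm) (Equiv.injective _) (Equiv.injective _)
  -- target side, the slices: relabel `Fin ((n_a−1)(m_b−1))` into the surviving pairs of block `(a,b)`
  have hT₂ : TensorRestrictsTo
      (blockSliceTensor K (fun x : {z : (Σ a : Fin p, Fin (ns a)) × (Σ b : Fin q, Fin (ms b)) //
          z.1 ≠ (fun a : Fin p => (⟨a, ⟨0, hn a⟩⟩ : Σ a : Fin p, Fin (ns a))) (Sigma.fst z.1) ∧
          z.2 ≠ (fun b : Fin q => (⟨b, ⟨0, hm b⟩⟩ : Σ b : Fin q, Fin (ms b))) (Sigma.fst z.2)} =>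
        (Sigma.fst x.1.1, Sigma.fst x.1.2)))
      (blockSliceTensor K (Sigma.fst :
        (Σ ab : Fin p × Fin q, Fin ((ns ab.1 - 1) * (ms ab.2 - 1))) → Fin p × Fin q)) := by
    refine tensorRestrictsTo_blockSliceTensor_of_comp_eq (K := K) (f := id)
      (e := fun y => ⟨(⟨y.1.1, ⟨(finProdFinEquiv.symm y.2).1.val + 1, by
            have := (finProdFinEquiv.symm y.2).1.isLt; omega⟩⟩,
          ⟨y.1.2, ⟨(finProdFinEquiv.symm y.2).2.val + 1, by
            have := (finProdFinEquiv.symm y.2).2.isLt; omega⟩⟩),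
        ⟨fun hh => by have := congrArg (fun s : (Σ a : Fin p, Fin (ns a)) => s.2.val) hh; simp at this,
         fun hh => by have := congrArg (fun s : (Σ b : Fin q, Fin (ms b)) => s.2.val) hh; simp at this⟩⟩)
      ?_ Function.injective_id (fun _ => rfl)
    rintro ⟨⟨a, b⟩, k⟩ ⟨⟨a', b'⟩, k'⟩ hyy'
    have h1 := congrArg (fun z : {z : (Σ a : Fin p, Fin (ns a)) × (Σ b : Fin q, Fin (ms b)) // _} =>
      z.1) hyy'
    simp only [Prod.mk.injEq] at h1
    obtain ⟨ha, hb⟩ := h1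
    obtain ⟨rfl, hu⟩ := Sigma.mk.inj_iff.mp ha
    obtain ⟨rfl, hv⟩ := Sigma.mk.inj_iff.mp hb
    have hu' := Fin.ext_iff.mp (eq_of_heq hu)
    have hv' := Fin.ext_iff.mp (eq_of_heq hv)
    simp only at hu' hv'
    have hk : finProdFinEquiv.symm k = finProdFinEquiv.symm k' :=
      Prod.ext (Fin.ext (by omega)) (Fin.ext (by omega))
    have := finProdFinEquiv.symm.injective hk
    subst this
    rfl
  exact (hS.algDegeneratesTo_trans h).trans_restrictsTo (hT₁.directSum hT₂)

/-! ## One block on each side: Schönhage's identity -/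

/-- `⟨N+1⟩ ≥ ⟨N⟩ ⊕ ⟨1,1,1⟩` (`⟨1,1,1⟩ = ⟨1⟩`; relabel along `Fin N ⊕ 1 ↪ Fin (N+1)`).
[cite: Blaser2013, Lemma 5.4] -/
theorem tensorRestrictsTo_unitTensor_succ_directSum (N : ℕ) :
    TensorRestrictsTo (unitTensor K (N + 1))
      (directSumTensor (unitTensor K N) (rotate (matMulTensor K 1 1 1))) := by
  have e : directSumTensor (unitTensor K N) (rotate (matMulTensor K 1 1 1)) = fun x y z =>
      unitTensor K (N + 1) (Sum.elim Fin.castSucc (fun _ => Fin.last N) x)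
        (Sum.elim Fin.castSucc (fun _ => Fin.last N) y)
        (Sum.elim Fin.castSucc (fun _ => Fin.last N) z) := by
    funext x y z
    rcases x with i | i <;> rcases y with j | j <;> rcases z with k | k <;>
      simp [directSumTensor, unitTensor_apply, rotate_apply, matMulTensor, Fin.castSucc_inj,
        (Fin.castSucc_lt_last _).ne, (Fin.castSucc_lt_last _).ne', eq_iff_true_of_subsingleton]
  rw [e]
  exact tensorRestrictsTo_precomp _ _ _ _

/-- **Schönhage's identity, as the one-block case of Thm. 7.3** (`p = q = 1`, `i* = j* = 0`):
`⟨n+1,1,m+1⟩ ⊕ ⟨1,nm,1⟩ ⊴ ⟨(n+1)(m+1) + 1⟩` — the classical construction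
`⟨n,1,m⟩ ⊕ ⟨1,(n−1)(m−1),1⟩ ⊴ ⟨nm+1⟩` that Thm. 7.3 generalises (p. 19 L80–86), here with
`⟨1,nm,1⟩ = rotate (oneSliceTensor K (Fin n × Fin m))`. [cite: AlmanLi2026, §7.3 (display before Thm. 7.3, "[Sch81Tau]")] -/
theorem thm73_schonhage (n m : ℕ) :
    AlgDegeneratesTo (unitTensor K ((n + 1) * (m + 1) + 1))
      (directSumTensor (rotate (matMulTensor K (n + 1) 1 (m + 1)))
        (rotate (oneSliceTensor K (Fin n × Fin m)))) := by
  -- Thm. 7.3 with one block of rows and one block of columns, distinguished elements `0`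
  have h := thm73 (K := K) (n + 1) (m + 1) 1 1 (fun _ => 0) (fun _ => 0) (fun _ => 0) (fun _ => 0)
    (fun a => Subsingleton.elim _ _) (fun b => Subsingleton.elim _ _)
  -- the surviving pairs `(i.succ, j.succ)` form the single block `≅ ⟨1, nm, 1⟩`
  have hT : TensorRestrictsTo
      (blockSliceTensor K (fun x : {z : Fin (n + 1) × Fin (m + 1) //
        z.1 ≠ (fun _ : Fin 1 => (0 : Fin (n + 1))) ((fun _ : Fin (n + 1) => (0 : Fin 1)) z.1) ∧
        z.2 ≠ (fun _ : Fin 1 => (0 : Fin (m + 1))) ((fun _ : Fin (m + 1) => (0 : Fin 1)) z.2)} =>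
          ((fun _ : Fin (n + 1) => (0 : Fin 1)) x.1.1, (fun _ : Fin (m + 1) => (0 : Fin 1)) x.1.2)))
      (rotate (oneSliceTensor K (Fin n × Fin m))) := by
    rw [← blockSliceTensor_const]
    refine tensorRestrictsTo_blockSliceTensor_of_comp_eq
      (e := fun y : Fin n × Fin m => ⟨(y.1.succ, y.2.succ), ⟨Fin.succ_ne_zero _, Fin.succ_ne_zero _⟩⟩)
      (f := fun _ : Unit => ((0 : Fin 1), (0 : Fin 1))) ?_ (fun _ _ _ => Subsingleton.elim _ _)
      (fun _ => rfl)
    intro y y' hyy'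
    have h1 := congrArg (fun x : {z : Fin (n + 1) × Fin (m + 1) // _} => x.1) hyy'
    simp only [Prod.mk.injEq, Fin.succ_inj] at h1
    exact Prod.ext h1.1 h1.2
  exact ((tensorRestrictsTo_unitTensor_succ_directSum (K := K) ((n + 1) * (m + 1))).algDegeneratesTo_trans
    h).trans_restrictsTo ((TensorRestrictsTo.refl _).directSum hT)

end AlmanLi2026

end Literature.Computability.AlgebraicComplexity
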